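import Summits.AtomisticToContinuum.BoseEinsteinCondensation.Theses.BECFeynmanVortexArea

/-!
# AtomisticToContinuum / BoseEinsteinCondensation — route `BECFeynmanVortexArea`, assembly

Settles the assembly item `stmt-AtomisticToContinuum-12609` of route
`route-AtomisticToContinuum-BECFeynmanVortexArea`: the implication

  `VortexAreaFloor → TorusGroundState → GroundStateRepresentation → NearConvexity →
    ZeroMomentumGround → MomentBoundCondensation → FreeGasCondensation → VortexAreaToPeriodicBEC →
    BoundaryTransferWeak → ScatteringLengthTransfer → BornRepresentativesExist →
    ScatteringLengthFinite → BoseEinsteinCondensation`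

(the audited sub-problem abbrev `_root_.BoseEinsteinCondensation`, by name).

The hypotheses of `Assembly` are, verbatim and in the same order, those of the route's deciding
theorem `closes`, so the assembly is that theorem; the composition is spelled out again below so
that this file depends only on the item statements. For an admissible `w` put
`a := (scatteringLength w).toReal` (finite by `ScatteringLengthFinite`, so
`ENNReal.ofReal a = scatteringLength w` by `ENNReal.ofReal_toReal`); `BornRepresentativesExist`
with `ε = 1` supplies a bounded admissible `v` with `scatteringLength v = ENNReal.ofReal a`;
`VortexAreaToPeriodicBEC` fed with `VortexAreaFloor`, `TorusGroundState`,
`GroundStateRepresentation`, `NearConvexity`, `ZeroMomentumGround`, `MomentBoundCondensation`,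
`FreeGasCondensation` gives periodic (torus) condensation of near-minimisers for the bounded `v`;
`BoundaryTransferWeak` turns it into `HasGroundStateBEC v ρ` for all small `ρ`, and
`ScatteringLengthTransfer v w` carries it to `w`. Pure logic; no analytic content lives here.

References: [LSSY2005, §1.2 and Ch. 5] (the conjunct being assembled), [Feynman1954],
[CorneanDerezinskiZin2009], [Stringari1995] (the route's mechanism, not used in this file).
-/

namespace Summit.AtomisticToContinuum.BoseEinsteinCondensation.Theorems

/-- **Item stmt-AtomisticToContinuum-12609** (`Assembly` of route `BECFeynmanVortexArea`, exact
route decl): the twelve items of the route imply the sub-problem statement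
`BoseEinsteinCondensation`. Proof: for admissible `w`, `ScatteringLengthFinite` and
`ENNReal.ofReal_toReal` give `ENNReal.ofReal (scatteringLength w).toReal = scatteringLength w`;
`BornRepresentativesExist 1 _ (scatteringLength w).toReal` yields a bounded admissible `v` of the
same scattering length; `ScatteringLengthTransfer v w` applied to
`BoundaryTransferWeak v` applied to the periodic-BEC body `VortexAreaToPeriodicBEC … v` concludes.
Pure composition of the route's hypotheses (the route's deciding theorem `closes`). [folklore] -/
theorem becFeynmanVortexArea_assembly_proof :
    Summit.AtomisticToContinuum.BoseEinsteinCondensation.Theses.BECFeynmanVortexArea.Assembly := by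
  unfold Theses.BECFeynmanVortexArea.Assembly
  intro hVA hGS hGR hNC hZM hMB hFG hBr hBT hST hRE hSF w hw
  obtain ⟨v, hv, hvM, -, hva⟩ := hRE 1 one_pos _
    (ENNReal.toReal_nonneg
      (a := Literature.MathematicalPhysics.QuantumManyBody.BoseGas.scatteringLength w))
  have hsl : Literature.MathematicalPhysics.QuantumManyBody.BoseGas.scatteringLength v =
      Literature.MathematicalPhysics.QuantumManyBody.BoseGas.scatteringLength w := by
    rw [hva, ENNReal.ofReal_toReal (hSF w hw)]
  exact hST v w hv hw hvM hsl (hBT v hv (hBr hVA hGS hGR hNC hZM hMB hFG v hv hvM))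

end Summit.AtomisticToContinuum.BoseEinsteinCondensation.Theorems
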